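import Literature.Computability.QuantumComplexity.PauliPathXEBEnumerator
import HarnessLib

/-!
# Linear-XEB scores of re-weighted low-degree Pauli-path estimators (frame model)

Topic `Literature/Computability/QuantumComplexity`, sub-namespace `PauliPath`; sequel of
`PauliPathXEBEnumerator` (real XEB vocabulary of the Pauli-frame model) and `PauliPathNoisyXEB`
(the bilinear frame orthogonality `sum_frame_sum_pathSum_mul_pathSum`).

HONEST FRAMING. The objects below are the LOW-DEGREE PATH SUMS of AGLLV23 §3 — "we simply use the
low-degree truncation to approximate the output distribution `p̃ ≈ Σ_{|s| ≤ ℓ} f̃(C,s,x)`"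
[cite: AharonovEtAl2023, §3 (display for the truncated estimator), arXiv p. 11] — with the printed
damping `(1−γ′)^{|s|}` replaced by an ARBITRARY real coefficient profile `a` (the printed estimator
`q̄_ℓ` at internal rate `γ′` is the member `a_s = (1−γ′)^{|s|}`). What is recorded is the exact value and
elementary upper bounds of the frame-averaged linear-XEB score of such a SIGNED LINEAR path sum against
the ideal framed circuit: identities and inequalities in the finite frame model, nothing about any other
estimator (tensor networks, adaptive or non-linear post-processing), no sampling procedure, and nothing
here proves or refutes a quantum advantage. MEANING CAVEAT: `pathEstimator` is a signed linear
quasi-estimator (`q ≥ 0` is NOT imposed); genuine samplers obtained from it by non-linear maps are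
outside this vocabulary unless already non-negative, and enter only through `positivityCap`.

## What is recorded (`n = |ι|`, `F = (4ⁿ)^{d+1}`, `w_s := 2^{2n} f(C,s,x₀)²`, `I…I` the trivial path)

* Vocabulary: `pathWt` (`w_s ∈ ℝ`, `Σ_{|s|=k} w_s = W_k`: `wt_eq_sum_pathWt`), `lowDegreeMass`
  (`W_{≤ℓ} := Σ_{1≤k≤ℓ} W_k = Σ_{1 ≤ |s| ≤ ℓ} w_s`: `lowDegreeMass_eq_sum_pathWt`), `pathEstimator`
  (`q_{a,W}(x) := Σ_{|s|≤ℓ} a_s f(C_W,s,x)`), `avgClassXEB` (`E_W` of the tree's `linearXEB` of `q_{a,W}`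
  against the ideal framed output), `ownExcess` (`κ_a := Σ_{1≤|s|≤ℓ} a_s² w_s`).
* **`avgClassXEB_add_one`** (a) — `E_W[XEB(q_a)] + 1 = Σ_{|s|≤ℓ} a_s w_s` (any layer matrices, any basis
  input): the bilinear orthogonality with profiles `1` and `a·[|s|≤ℓ]`
  [cite: AharonovEtAl2023, Lemma 3 and §5 (display before Theorem 4)].
* **`subDepthTruncationScore`** (b) — for unitary layers and `ℓ ≤ d`, `E_W[XEB(q_a)] = a_{I…I} − 1`
  (`W_k = 0` for `0 < k ≤ d`, `W_0 = 1`) [cite: AharonovEtAl2023, Lemma 4 (items 1–2)].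
* **`truncationClassCeiling`** (c) — `|a_s| ≤ A`, `a_{I…I} ≤ 1` ⟹ `E_W[XEB(q_a)] ≤ A · W_{≤ℓ}`.
* **`ownExcessIdentity`** (c-κ) — `E_W[2ⁿ Σ_x q_{a,W}(x)²] = a_{I…I}² + κ_a` (orthogonality, `w_{I…I} = 1`)
  [cite: AharonovEtAl2023, Lemma 3 and Lemma 4 (item 1)].
* **`truncationClassCeilingCS`** (c′) — `E_W[XEB(q_a)] ≤ (a_{I…I} − 1) + √(κ_a · W_{≤ℓ})` (Cauchy–Schwarz).
* **`sum_pathEstimator`** — `Σ_x q_{a,W}(x) = a_{I…I}` for unitary layers (only the trivial path has a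
  non-zero total, [cite: AharonovEtAl2023, Lemma 4 (item 1) and Lemma 5]); **`positivityCap`** (P_κ) — a
  member that is point-wise non-negative with `a_{I…I} = 1` and bounded by `M_W` in frame `W` has
  `κ_a ≤ E_W[2ⁿ M_W] − 1`.

Items (a)–(P_κ) are the statement records of the cell line `truncation-class-xeb-ceiling`, landed as
theorems; the line's hypotheses on gate-random ensembles are NOT recorded here.

## References

* [AharonovEtAl2023] D. Aharonov, X. Gao, Z. Landau, Y. Liu, U. Vazirani, *A polynomial-time classical
  algorithm for noisy random circuit sampling*, STOC 2023, 945–957, arXiv:2211.03999 — §2 (Lemmas 3–5,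
  Definition 5), §3 (the truncated estimator), §5 (XEB display).
* [BarakChouGao2021] B. Barak, C.-N. Chou, X. Gao, *Spoofing linear cross-entropy benchmarking in
  shallow quantum circuits*, ITCS 2021, arXiv:2005.02421 — the linear XEB functional (`linearXEB`).
-/

noncomputable section

open Matrix Finset
open Literature.Barriers.QuantumAdvantage (linearXEB)

namespace Literature.Computability.QuantumComplexity

namespace PauliPath

variable {ι : Type*} [Fintype ι] [DecidableEq ι]

/-! ### Auxiliary: realness, the framed layers are unitary, sums over the read-out -/

omit [Fintype ι] [DecidableEq ι] in
/-- The conjugation signs are real. [cite: AharonovEtAl2023, §2 (proof of Lemma 2: V P V† = ±P)] -/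
private theorem conj_sign'' (Q P : Pauli) : (starRingEnd ℂ) (Pauli.sign Q P) = Pauli.sign Q P := by
  unfold Pauli.sign
  split_ifs <;> simp

omit [DecidableEq ι] in
/-- The sign characters are real. [cite: AharonovEtAl2023, §2 (proof of Lemma 2)] -/
private theorem conj_strSign'' (W S : ι → Pauli) : (starRingEnd ℂ) (strSign W S) = strSign W S := by
  rw [strSign_eq, map_prod]
  exact Finset.prod_congr rfl fun i _ => conj_sign'' _ _

omit [Fintype ι] [DecidableEq ι] in
/-- The square of a real complex number is the cast of its squared modulus. [cite: AharonovEtAl2023, §2 (f(C,s,x) ∈ ℝ)] -/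
private theorem sq_eq_ofReal_norm_sq'' {z : ℂ} (hz : (starRingEnd ℂ) z = z) :
    z ^ 2 = ((‖z‖ ^ 2 : ℝ) : ℂ) := by
  obtain ⟨t, rfl⟩ : ∃ t : ℝ, (t : ℂ) = z := ⟨z.re, Complex.conj_eq_iff_re.mp hz⟩
  rw [Complex.norm_real, Real.norm_eq_abs, sq_abs]
  push_cast
  ring

/-- The framed coefficient `f(C_W,s,x)` on a basis input is real.
[cite: AharonovEtAl2023, §2 (f(C,s,x) ∈ ℝ) and Lemma 3 (proof: frames flip signs)] -/
theorem conj_pathCoeff_frame_proj {d : ℕ} (U : Fin d → Matrix (ι → Bool) (ι → Bool) ℂ) (y : ι → Bool)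
    (W s : Fin (d + 1) → ι → Pauli) (x : ι → Bool) :
    (starRingEnd ℂ) (pathCoeff 0 (frameLayers U W) (proj y) (frameObs (proj x) W) s) =
      pathCoeff 0 (frameLayers U W) (proj y) (frameObs (proj x) W) s := by
  rw [pathCoeff_frame, map_mul, map_prod,
    conj_pathCoeff_zero U (conjTranspose_proj y) (conjTranspose_proj x) s]
  congr 1
  exact Finset.prod_congr rfl fun t _ => conj_strSign'' _ _

/-- The framed layers `U_t W_t` are unitary when the layers are (Pauli strings are unitary).
[cite: AharonovEtAl2023, Definition 3] -/
theorem frameLayers_mem_unitaryGroup {d : ℕ} {U : Fin d → Matrix (ι → Bool) (ι → Bool) ℂ}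
    (hU : ∀ t, U t ∈ Matrix.unitaryGroup (ι → Bool) ℂ) (W : Fin (d + 1) → ι → Pauli) (t : Fin d) :
    frameLayers U W t ∈ Matrix.unitaryGroup (ι → Bool) ℂ := by
  rw [frameLayers_apply]
  refine Submonoid.mul_mem _ (hU t) ?_
  rw [Matrix.mem_unitaryGroup_iff, star_eq_conjTranspose, conjTranspose_pauliString,
    pauliString_mul_self]

/-- `Σ_x |x⟩⟨x| = 1`. [cite: AharonovEtAl2023, §2 (Table 1)] -/
theorem sum_proj : ∑ x : ι → Bool, proj x = (1 : Matrix (ι → Bool) (ι → Bool) ℂ) := by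
  ext a b
  simp only [Matrix.sum_apply, proj_apply, Matrix.one_apply]
  by_cases hab : a = b
  · subst hab
    simp
  · rw [if_neg hab]
    exact Finset.sum_eq_zero fun x _ => if_neg fun h => hab (h.1.trans h.2.symm)

/-- `Σ_x W |x⟩⟨x| W = 1` for the framed read-outs. [cite: AharonovEtAl2023, Definition 3 (final layer)] -/
theorem sum_frameObs_proj {d : ℕ} (W : Fin (d + 1) → ι → Pauli) :
    ∑ x : ι → Bool, frameObs (proj x) W = (1 : Matrix (ι → Bool) (ι → Bool) ℂ) := by
  simp only [frameObs, ← Finset.sum_mul, ← Finset.mul_sum, sum_proj, Matrix.mul_one,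
    pauliString_mul_self]

/-- The path coefficient is additive in the read-out over finite sums.
[cite: AharonovEtAl2023, Definition 2 (f̃ is linear in the read-out bracket)] -/
theorem pathCoeff_sum_obs {κ : Type*} (S : Finset κ) (γ : ℂ) {d : ℕ}
    (U : Fin d → Matrix (ι → Bool) (ι → Bool) ℂ) (ρ : Matrix (ι → Bool) (ι → Bool) ℂ)
    (O : κ → Matrix (ι → Bool) (ι → Bool) ℂ) (s : Fin (d + 1) → ι → Pauli) :
    pathCoeff γ U ρ (∑ k ∈ S, O k) s = ∑ k ∈ S, pathCoeff γ U ρ (O k) s := by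
  simp only [pathCoeff, Finset.sum_mul, Matrix.trace_sum, Finset.mul_sum]

/-- **Only the trivial path has a non-zero read-out total**: with read-out `1` (the sum of all basis
projectors), unitary layers and a basis input, the trivial path gives `1` and every other path gives `0`
(an illegal path vanishes, Lemma 5; a legal non-trivial path ends in a traceless string).
[cite: AharonovEtAl2023, Lemma 4 (item 1) and Lemma 5] -/
theorem pathCoeff_obs_one (γ : ℂ) {d : ℕ} {V : Fin d → Matrix (ι → Bool) (ι → Bool) ℂ}
    (hV : ∀ t, V t ∈ Matrix.unitaryGroup (ι → Bool) ℂ) (y : ι → Bool) (s : Fin (d + 1) → ι → Pauli) :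
    pathCoeff γ V (proj y) 1 s = if s = (fun _ _ => Pauli.I) then 1 else 0 := by
  split_ifs with hs
  · subst hs
    rw [pathCoeff_const_I γ hV, Matrix.trace_one, trace_proj, Fintype.card_fun, Fintype.card_bool,
      mul_one]
    push_cast
    exact inv_mul_cancel₀ (pow_ne_zero _ two_ne_zero)
  · by_cases hleg : LayerLegal s
    · rcases layerLegal_dichotomy hleg with hall | hnone
      · exact absurd (funext hall) hs
      · rw [pathCoeff, Matrix.one_mul, depolarizeAll_pauliString, Matrix.trace_smul, smul_eq_mul,
          trace_pauliString_eq_zero (hnone _), mul_zero, zero_mul, zero_mul, mul_zero]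
    · exact pathCoeff_eq_zero_of_not_layerLegal γ hV _ _ hleg

/-- Hence, summed over the read-out, the framed coefficients are `[s = I…I]` (unitary layers, basis input).
[cite: AharonovEtAl2023, Lemma 4 (item 1) and Lemma 5] -/
theorem sum_pathCoeff_frame_proj (γ : ℂ) {d : ℕ} {U : Fin d → Matrix (ι → Bool) (ι → Bool) ℂ}
    (hU : ∀ t, U t ∈ Matrix.unitaryGroup (ι → Bool) ℂ) (y : ι → Bool)
    (W s : Fin (d + 1) → ι → Pauli) :
    ∑ x : ι → Bool, pathCoeff γ (frameLayers U W) (proj y) (frameObs (proj x) W) s =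
      if s = (fun _ _ => Pauli.I) then 1 else 0 := by
  rw [← pathCoeff_sum_obs, sum_frameObs_proj, pathCoeff_obs_one γ (frameLayers_mem_unitaryGroup hU W) y s]

/-! ### Vocabulary -/

/-- The single-path weight `w_s = 2^{2n} f(C,s,x₀)²` (noiseless, frame-invariant, real; `Σ_{|s|=k} w_s = W_k`).
[cite: AharonovEtAl2023, Definition 5 (Fourier weight, summand)] -/
def pathWt {d : ℕ} (U : Fin d → Matrix (ι → Bool) (ι → Bool) ℂ) (y x₀ : ι → Bool)
    (s : Fin (d + 1) → ι → Pauli) : ℝ :=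
  (((2 : ℂ) ^ Fintype.card ι) ^ 2 * pathCoeff 0 U (proj y) (proj x₀) s ^ 2).re

/-- Cumulative LOW-DEGREE FOURIER MASS above the trivial path, `W_{≤ℓ} := Σ_{1 ≤ k ≤ ℓ} W_k`.
[cite: AharonovEtAl2023, Definition 5 and Lemma 4] -/
def lowDegreeMass {d : ℕ} (U : Fin d → Matrix (ι → Bool) (ι → Bool) ℂ) (y x₀ : ι → Bool) (ℓ : ℕ) : ℝ :=
  ∑ k ∈ (Finset.range (ℓ + 1)).filter (fun k => k ≠ 0), wt U y x₀ k

/-- The re-weighted low-degree path sum `q_{a,W}(x) := Σ_{|s| ≤ ℓ} a_s · f(C_W, s, x)` with a real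
coefficient profile `a` (coefficients on weights `> ℓ` are ignored): the printed truncated estimator
`Σ_{|s|≤ℓ} f̃(C,s,x)` is the member `a_s = (1−γ)^{|s|}`; a SIGNED LINEAR quasi-estimator in general.
[cite: AharonovEtAl2023, §3 (display: p̃ ≈ Σ_{|s|≤ℓ} f̃(C,s,x)), arXiv p. 11] -/
def pathEstimator {d : ℕ} (ℓ : ℕ) (a : (Fin (d + 1) → ι → Pauli) → ℝ)
    (U : Fin d → Matrix (ι → Bool) (ι → Bool) ℂ) (y : ι → Bool)
    (W : Fin (d + 1) → ι → Pauli) (x : ι → Bool) : ℝ :=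
  (∑ s ∈ Finset.univ.filter (fun s : Fin (d + 1) → ι → Pauli => pathWeight s ≤ ℓ),
    (a s : ℂ) * pathCoeff 0 (frameLayers U W) (proj y) (frameObs (proj x) W) s).re

/-- Frame-averaged linear-XEB score of the path sum `q_a` against the ideal framed circuit.
[cite: AharonovEtAl2023, §5 (display defining the linear cross entropy of a simulation q)] -/
def avgClassXEB {d : ℕ} (ℓ : ℕ) (a : (Fin (d + 1) → ι → Pauli) → ℝ)
    (U : Fin d → Matrix (ι → Bool) (ι → Bool) ℂ) (y : ι → Bool) : ℝ :=
  (∑ W : Fin (d + 1) → ι → Pauli, linearXEB (idealOut U y W) (pathEstimator ℓ a U y W)) /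
    frameCount ι d

/-- The path sum's OWN EXCESS COLLISION MASS on non-trivial low-degree paths,
`κ_a := Σ_{1 ≤ |s| ≤ ℓ} a_s² w_s` (read off the member's frame-averaged second moment,
`ownExcessIdentity`). [cite: AharonovEtAl2023, Lemma 3 (orthogonality) and Definition 5] -/
def ownExcess {d : ℕ} (ℓ : ℕ) (a : (Fin (d + 1) → ι → Pauli) → ℝ)
    (U : Fin d → Matrix (ι → Bool) (ι → Bool) ℂ) (y x₀ : ι → Bool) : ℝ :=
  ∑ s ∈ Finset.univ.filter (fun s : Fin (d + 1) → ι → Pauli => pathWeight s ≤ ℓ ∧ pathWeight s ≠ 0),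
    a s ^ 2 * pathWt U y x₀ s

/-! ### The single-path weights -/

/-- `w_s` is the cast of the tree's complex summand. [cite: AharonovEtAl2023, Definition 5] -/
theorem ofReal_pathWt {d : ℕ} (U : Fin d → Matrix (ι → Bool) (ι → Bool) ℂ) (y x₀ : ι → Bool)
    (s : Fin (d + 1) → ι → Pauli) :
    ((pathWt U y x₀ s : ℝ) : ℂ) = ((2 : ℂ) ^ Fintype.card ι) ^ 2 * pathCoeff 0 U (proj y) (proj x₀) s ^ 2 := by
  refine Complex.conj_eq_iff_re.mp ?_
  simp only [map_mul, map_pow, map_ofNat, conj_pathCoeff_zero U (conjTranspose_proj y) (conjTranspose_proj x₀)]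

/-- `w_s = 2^{2n} |f(C,s,x₀)|²`. [cite: AharonovEtAl2023, Definition 5] -/
theorem pathWt_eq_norm_sq {d : ℕ} (U : Fin d → Matrix (ι → Bool) (ι → Bool) ℂ) (y x₀ : ι → Bool)
    (s : Fin (d + 1) → ι → Pauli) :
    pathWt U y x₀ s = ((2 : ℝ) ^ Fintype.card ι) ^ 2 * ‖pathCoeff 0 U (proj y) (proj x₀) s‖ ^ 2 := by
  have h : ((2 : ℂ) ^ Fintype.card ι) ^ 2 * pathCoeff 0 U (proj y) (proj x₀) s ^ 2 =
      ((((2 : ℝ) ^ Fintype.card ι) ^ 2 * ‖pathCoeff 0 U (proj y) (proj x₀) s‖ ^ 2 : ℝ) : ℂ) := by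
    rw [sq_eq_ofReal_norm_sq'' (conj_pathCoeff_zero U (conjTranspose_proj y) (conjTranspose_proj x₀) s)]
    push_cast
    ring
  rw [pathWt, h, Complex.ofReal_re]

/-- `w_s ≥ 0`. [cite: AharonovEtAl2023, Definition 5] -/
theorem pathWt_nonneg {d : ℕ} (U : Fin d → Matrix (ι → Bool) (ι → Bool) ℂ) (y x₀ : ι → Bool)
    (s : Fin (d + 1) → ι → Pauli) : 0 ≤ pathWt U y x₀ s := by
  rw [pathWt_eq_norm_sq]
  positivity

/-- `w_{I…I} = 1` for unitary layers (`W_0 = 1`). [cite: AharonovEtAl2023, Lemma 4 (item 1)] -/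
theorem pathWt_const_I {d : ℕ} {U : Fin d → Matrix (ι → Bool) (ι → Bool) ℂ}
    (hU : ∀ t, U t ∈ Matrix.unitaryGroup (ι → Bool) ℂ) (y x₀ : ι → Bool) :
    pathWt U y x₀ (fun _ _ => Pauli.I) = 1 := by
  have h := fourierWeight_zero 0 hU x₀ y
  simp [pathWt, h]

/-- `w_s = 0` for `1 ≤ |s| ≤ d` and unitary layers (`W_k = 0` for `0 < k ≤ d`).
[cite: AharonovEtAl2023, Lemma 4 (item 2)] -/
theorem pathWt_eq_zero_of_le {d : ℕ} {U : Fin d → Matrix (ι → Bool) (ι → Bool) ℂ}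
    (hU : ∀ t, U t ∈ Matrix.unitaryGroup (ι → Bool) ℂ) (y x₀ : ι → Bool)
    {s : Fin (d + 1) → ι → Pauli} (hs0 : pathWeight s ≠ 0) (hsd : pathWeight s ≤ d) :
    pathWt U y x₀ s = 0 := by
  have hc : pathCoeff 0 U (proj y) (proj x₀) s = 0 := by
    by_contra hne
    rcases pathWeight_eq_zero_or_lt_of_pathCoeff_ne_zero 0 hU (proj y) (proj x₀) hne with h0 | hlt
    · exact hs0 h0
    · omega
  simp [pathWt, hc]

/-- `W_k = Σ_{|s| = k} w_s`. [cite: AharonovEtAl2023, Definition 5] -/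
theorem wt_eq_sum_pathWt {d : ℕ} (U : Fin d → Matrix (ι → Bool) (ι → Bool) ℂ) (y x₀ : ι → Bool) (k : ℕ) :
    wt U y x₀ k = ∑ s ∈ Finset.univ.filter (fun s : Fin (d + 1) → ι → Pauli => pathWeight s = k),
      pathWt U y x₀ s := by
  have h : ((wt U y x₀ k : ℝ) : ℂ) = ((∑ s ∈ Finset.univ.filter
      (fun s : Fin (d + 1) → ι → Pauli => pathWeight s = k), pathWt U y x₀ s : ℝ) : ℂ) := by
    rw [ofReal_wt, fourierWeight, Finset.mul_sum]
    push_cast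
    exact Finset.sum_congr rfl fun s _ => (ofReal_pathWt U y x₀ s).symm
  exact_mod_cast h

/-- Membership in the set of non-trivial low-degree paths `1 ≤ |s| ≤ ℓ`. [cite: AharonovEtAl2023, Definition 5] -/
private theorem mem_filter_low {d : ℕ} (ℓ : ℕ) (s : Fin (d + 1) → ι → Pauli) :
    s ∈ Finset.univ.filter (fun s : Fin (d + 1) → ι → Pauli => pathWeight s ≤ ℓ ∧ pathWeight s ≠ 0) ↔
      pathWeight s ≤ ℓ ∧ pathWeight s ≠ 0 := by
  simp

/-- `W_{≤ℓ} = Σ_{1 ≤ |s| ≤ ℓ} w_s` (regrouping by weight). [cite: AharonovEtAl2023, Definition 5] -/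
theorem lowDegreeMass_eq_sum_pathWt {d : ℕ} (U : Fin d → Matrix (ι → Bool) (ι → Bool) ℂ)
    (y x₀ : ι → Bool) (ℓ : ℕ) :
    lowDegreeMass U y x₀ ℓ =
      ∑ s ∈ Finset.univ.filter (fun s : Fin (d + 1) → ι → Pauli => pathWeight s ≤ ℓ ∧ pathWeight s ≠ 0),
        pathWt U y x₀ s := by
  rw [lowDegreeMass]
  simp_rw [wt_eq_sum_pathWt]
  rw [← Finset.sum_fiberwise_of_maps_to (g := pathWeight)
    (t := (Finset.range (ℓ + 1)).filter (fun k => k ≠ 0))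
    (fun s hs => by
      rw [mem_filter_low] at hs
      exact Finset.mem_filter.2 ⟨Finset.mem_range.2 (Nat.lt_succ_of_le hs.1), hs.2⟩)]
  refine Finset.sum_congr rfl fun k hk => Finset.sum_congr ?_ fun _ _ => rfl
  obtain ⟨hk1, hk0⟩ := Finset.mem_filter.1 hk
  have hkℓ : k ≤ ℓ := Nat.lt_succ_iff.1 (Finset.mem_range.1 hk1)
  ext s
  simp only [Finset.mem_filter, Finset.mem_univ, true_and]
  constructor
  · intro h
    exact ⟨⟨h ▸ hkℓ, h ▸ hk0⟩, h⟩
  · exact fun h => h.2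

/-- `W_{≤ℓ} ≥ 0`. [cite: AharonovEtAl2023, Definition 5] -/
theorem lowDegreeMass_nonneg {d : ℕ} (U : Fin d → Matrix (ι → Bool) (ι → Bool) ℂ) (y x₀ : ι → Bool)
    (ℓ : ℕ) : 0 ≤ lowDegreeMass U y x₀ ℓ := by
  rw [lowDegreeMass_eq_sum_pathWt]
  exact Finset.sum_nonneg fun s _ => pathWt_nonneg U y x₀ s

/-- Splitting a sum over `|s| ≤ ℓ` into the trivial path and the paths with `1 ≤ |s| ≤ ℓ`.
[cite: AharonovEtAl2023, Lemma 4 (item 1: the unique all-identity path)] -/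
theorem sum_filter_le_eq_add {d : ℕ} (ℓ : ℕ) (g : (Fin (d + 1) → ι → Pauli) → ℝ) :
    ∑ s ∈ Finset.univ.filter (fun s : Fin (d + 1) → ι → Pauli => pathWeight s ≤ ℓ), g s =
      g (fun _ _ => Pauli.I) +
        ∑ s ∈ Finset.univ.filter
          (fun s : Fin (d + 1) → ι → Pauli => pathWeight s ≤ ℓ ∧ pathWeight s ≠ 0), g s := by
  have hI : (fun _ _ => Pauli.I : Fin (d + 1) → ι → Pauli) ∈
      Finset.univ.filter (fun s : Fin (d + 1) → ι → Pauli => pathWeight s ≤ ℓ) := by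
    simp [pathWeight_eq_zero_iff.2 rfl]
  rw [← Finset.add_sum_erase _ _ hI]
  congr 1
  refine Finset.sum_congr ?_ fun _ _ => rfl
  ext s
  simp only [Finset.mem_erase, Finset.mem_filter, Finset.mem_univ, true_and, ne_eq,
    pathWeight_eq_zero_iff]
  tauto

/-! ### (a) The exact XEB currency of a path sum -/

/-- `q_{a,W}(x)` is the cast of a complex path sum with the indicator profile.
[cite: AharonovEtAl2023, §3 (truncated estimator)] -/
theorem ofReal_pathEstimator {d : ℕ} (ℓ : ℕ) (a : (Fin (d + 1) → ι → Pauli) → ℝ)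
    (U : Fin d → Matrix (ι → Bool) (ι → Bool) ℂ) (y : ι → Bool) (W : Fin (d + 1) → ι → Pauli)
    (x : ι → Bool) :
    ((pathEstimator ℓ a U y W x : ℝ) : ℂ) =
      ∑ s, (if pathWeight s ≤ ℓ then (a s : ℂ) else 0) *
        pathCoeff 0 (frameLayers U W) (proj y) (frameObs (proj x) W) s := by
  have h : (starRingEnd ℂ) (∑ s ∈ Finset.univ.filter (fun s : Fin (d + 1) → ι → Pauli => pathWeight s ≤ ℓ),
      (a s : ℂ) * pathCoeff 0 (frameLayers U W) (proj y) (frameObs (proj x) W) s) =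
      ∑ s ∈ Finset.univ.filter (fun s : Fin (d + 1) → ι → Pauli => pathWeight s ≤ ℓ),
        (a s : ℂ) * pathCoeff 0 (frameLayers U W) (proj y) (frameObs (proj x) W) s := by
    rw [map_sum]
    exact Finset.sum_congr rfl fun s _ => by
      rw [map_mul, Complex.conj_ofReal, conj_pathCoeff_frame_proj]
  rw [pathEstimator, Complex.conj_eq_iff_re.mp h, Finset.sum_filter]
  exact Finset.sum_congr rfl fun s _ => by
    split_ifs <;> simp

/-- The frame-summed score of any candidate against the ideal framed output:
`Σ_W XEB(q_W) = 2ⁿ Σ_W Σ_x p_W(x) q_W(x) − F`. [cite: AharonovEtAl2023, §5 (display defining XEB)] -/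
theorem sum_linearXEB_idealOut {d : ℕ} (U : Fin d → Matrix (ι → Bool) (ι → Bool) ℂ) (y : ι → Bool)
    (q : (Fin (d + 1) → ι → Pauli) → (ι → Bool) → ℝ) :
    ∑ W : Fin (d + 1) → ι → Pauli, linearXEB (idealOut U y W) (q W) =
      (2 : ℝ) ^ Fintype.card ι * ∑ W : Fin (d + 1) → ι → Pauli, ∑ x, idealOut U y W x * q W x -
        frameCount ι d := by
  rw [← card_frame_eq (ι := ι) d]
  simp only [linearXEB, Fintype.card_fun, Fintype.card_bool, Finset.sum_sub_distrib, Finset.mul_sum,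
    Finset.sum_const, Finset.card_univ, nsmul_eq_mul, mul_one]
  push_cast
  simp only [Fintype.card_fin, Pauli.card_univ]

/-- **(a) EXACT CURRENCY**: `E_W[XEB(q_a)] + 1 = Σ_{|s| ≤ ℓ} a_s w_s` for every real coefficient profile
(any layer matrices, any basis input `y`, any reference output `x₀`): the bilinear frame
orthogonality `sum_frame_sum_pathSum_mul_pathSum` with profiles `1` and `a · [|s| ≤ ℓ]`.
[cite: AharonovEtAl2023, Lemma 3 and §5 (display before Theorem 4)] -/
theorem avgClassXEB_add_one {d : ℕ} (ℓ : ℕ) (a : (Fin (d + 1) → ι → Pauli) → ℝ)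
    (U : Fin d → Matrix (ι → Bool) (ι → Bool) ℂ) (y x₀ : ι → Bool) :
    avgClassXEB ℓ a U y + 1 =
      ∑ s ∈ Finset.univ.filter (fun s : Fin (d + 1) → ι → Pauli => pathWeight s ≤ ℓ),
        a s * pathWt U y x₀ s := by
  have hF := frameCount_pos ι d
  set b : (Fin (d + 1) → ι → Pauli) → ℂ := fun s => if pathWeight s ≤ ℓ then (a s : ℂ) else 0 with hb
  have hC := sum_frame_sum_pathSum_mul_pathSum (fun _ => (1 : ℂ)) b U (proj y) x₀
  simp only [one_mul] at hC
  have hL : (((2 : ℝ) ^ Fintype.card ι * ∑ W : Fin (d + 1) → ι → Pauli, ∑ x : ι → Bool,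
      idealOut U y W x * pathEstimator ℓ a U y W x : ℝ) : ℂ) =
      (2 : ℂ) ^ Fintype.card ι * ∑ W : Fin (d + 1) → ι → Pauli, ∑ x : ι → Bool,
        (∑ s, pathCoeff 0 (frameLayers U W) (proj y) (frameObs (proj x) W) s) *
          (∑ s, b s * pathCoeff 0 (frameLayers U W) (proj y) (frameObs (proj x) W) s) := by
    push_cast
    simp_rw [ofReal_idealOut, noisyValue_eq_sum_pathCoeff, ofReal_pathEstimator, hb]
  have hR : ((frameCount ι d * ∑ s ∈ Finset.univ.filter
      (fun s : Fin (d + 1) → ι → Pauli => pathWeight s ≤ ℓ), a s * pathWt U y x₀ s : ℝ) : ℂ) =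
      ((4 : ℂ) ^ Fintype.card ι) ^ (d + 1) *
        ∑ s, b s * (((2 : ℂ) ^ Fintype.card ι) ^ 2 * pathCoeff 0 U (proj y) (proj x₀) s ^ 2) := by
    unfold frameCount
    push_cast
    rw [Finset.sum_filter]
    congr 1
    exact Finset.sum_congr rfl fun s _ => by
      simp only [hb]
      split_ifs
      · rw [ofReal_pathWt]
      · rw [zero_mul]
  have hreal : (2 : ℝ) ^ Fintype.card ι * ∑ W : Fin (d + 1) → ι → Pauli, ∑ x : ι → Bool,
      idealOut U y W x * pathEstimator ℓ a U y W x =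
      frameCount ι d * ∑ s ∈ Finset.univ.filter
        (fun s : Fin (d + 1) → ι → Pauli => pathWeight s ≤ ℓ), a s * pathWt U y x₀ s := by
    exact_mod_cast hL.trans (hC.trans hR.symm)
  rw [avgClassXEB, sum_linearXEB_idealOut, hreal]
  field_simp
  ring

/-- (a) rewritten over the non-trivial paths: `E_W[XEB(q_a)] = a_{I…I} − 1 + Σ_{1≤|s|≤ℓ} a_s w_s`
(unitary layers: `w_{I…I} = 1`). [cite: AharonovEtAl2023, Lemma 4 (item 1)] -/
theorem avgClassXEB_eq {d : ℕ} (ℓ : ℕ) (a : (Fin (d + 1) → ι → Pauli) → ℝ)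
    {U : Fin d → Matrix (ι → Bool) (ι → Bool) ℂ} (hU : ∀ t, U t ∈ Matrix.unitaryGroup (ι → Bool) ℂ)
    (y x₀ : ι → Bool) :
    avgClassXEB ℓ a U y = a (fun _ _ => Pauli.I) - 1 +
      ∑ s ∈ Finset.univ.filter
        (fun s : Fin (d + 1) → ι → Pauli => pathWeight s ≤ ℓ ∧ pathWeight s ≠ 0),
          a s * pathWt U y x₀ s := by
  have h := avgClassXEB_add_one ℓ a U y x₀
  rw [sum_filter_le_eq_add, pathWt_const_I hU, mul_one] at h
  linarith

/-! ### (b) Sub-depth truncation scores exactly its trivial-path bias -/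

/-- **(b)** For unitary layers and `ℓ ≤ d`, every path sum scores `E_W[XEB(q_a)] = a_{I…I} − 1` — in
particular the normalised truncated estimator (`a_{I…I} = 1`) scores exactly `0` at every internal
damping. [cite: AharonovEtAl2023, Lemma 4 (items 1–2: W_0 = 1, W_k = 0 for 0 < k ≤ d)] -/
theorem subDepthTruncationScore {d : ℕ} (ℓ : ℕ) (hℓ : ℓ ≤ d) (a : (Fin (d + 1) → ι → Pauli) → ℝ)
    {U : Fin d → Matrix (ι → Bool) (ι → Bool) ℂ} (hU : ∀ t, U t ∈ Matrix.unitaryGroup (ι → Bool) ℂ)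
    (y : ι → Bool) : avgClassXEB ℓ a U y = a (fun _ _ => Pauli.I) - 1 := by
  rw [avgClassXEB_eq ℓ a hU y y, add_eq_left]
  exact Finset.sum_eq_zero fun s hs => by
    obtain ⟨hsℓ, hs0⟩ := (mem_filter_low ℓ s).1 hs
    rw [pathWt_eq_zero_of_le hU y y hs0 (hsℓ.trans hℓ), mul_zero]

/-! ### (c) The ceiling by the low-degree Fourier mass -/

/-- **(c) THE CEILING**: amplification `|a_s| ≤ A` and trivial coefficient `a_{I…I} ≤ 1` give
`E_W[XEB(q_a)] ≤ A · W_{≤ℓ}` (unitary layers, basis input; `w_s ≥ 0`).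
[cite: AharonovEtAl2023, Lemma 4 and Definition 5] -/
theorem truncationClassCeiling {d : ℕ} (ℓ : ℕ) (A : ℝ) (a : (Fin (d + 1) → ι → Pauli) → ℝ)
    (ha : ∀ s, |a s| ≤ A) (haI : a (fun _ _ => Pauli.I) ≤ 1)
    {U : Fin d → Matrix (ι → Bool) (ι → Bool) ℂ} (hU : ∀ t, U t ∈ Matrix.unitaryGroup (ι → Bool) ℂ)
    (y x₀ : ι → Bool) : avgClassXEB ℓ a U y ≤ A * lowDegreeMass U y x₀ ℓ := by
  rw [avgClassXEB_eq ℓ a hU y x₀, lowDegreeMass_eq_sum_pathWt, Finset.mul_sum]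
  have hsum : ∑ s ∈ Finset.univ.filter
      (fun s : Fin (d + 1) → ι → Pauli => pathWeight s ≤ ℓ ∧ pathWeight s ≠ 0), a s * pathWt U y x₀ s ≤
      ∑ s ∈ Finset.univ.filter
        (fun s : Fin (d + 1) → ι → Pauli => pathWeight s ≤ ℓ ∧ pathWeight s ≠ 0), A * pathWt U y x₀ s :=
    Finset.sum_le_sum fun s _ =>
      mul_le_mul_of_nonneg_right ((le_abs_self _).trans (ha s)) (pathWt_nonneg U y x₀ s)
  linarith

/-! ### (c-κ) The own excess collision mass and (c′) the Cauchy–Schwarz ceiling -/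

/-- **(c-κ)** `E_W[2ⁿ Σ_x q_{a,W}(x)²] = a_{I…I}² + κ_a` (unitary layers, basis input): the member's
frame-averaged collision number is read off its coefficient profile by orthogonality and `w_{I…I} = 1`.
[cite: AharonovEtAl2023, Lemma 3 (orthogonality) and Lemma 4 (item 1)] -/
theorem ownExcessIdentity {d : ℕ} (ℓ : ℕ) (a : (Fin (d + 1) → ι → Pauli) → ℝ)
    {U : Fin d → Matrix (ι → Bool) (ι → Bool) ℂ} (hU : ∀ t, U t ∈ Matrix.unitaryGroup (ι → Bool) ℂ)
    (y x₀ : ι → Bool) :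
    (∑ W : Fin (d + 1) → ι → Pauli, (2 : ℝ) ^ Fintype.card ι * ∑ x : ι → Bool,
        pathEstimator ℓ a U y W x ^ 2) / frameCount ι d =
      a (fun _ _ => Pauli.I) ^ 2 + ownExcess ℓ a U y x₀ := by
  have hF := frameCount_pos ι d
  set b : (Fin (d + 1) → ι → Pauli) → ℂ := fun s => if pathWeight s ≤ ℓ then (a s : ℂ) else 0 with hb
  have hC := sum_frame_sum_pathSum_mul_pathSum b b U (proj y) x₀
  have hL : ((∑ W : Fin (d + 1) → ι → Pauli, (2 : ℝ) ^ Fintype.card ι * ∑ x : ι → Bool,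
      pathEstimator ℓ a U y W x ^ 2 : ℝ) : ℂ) =
      (2 : ℂ) ^ Fintype.card ι * ∑ W : Fin (d + 1) → ι → Pauli, ∑ x : ι → Bool,
        (∑ s, b s * pathCoeff 0 (frameLayers U W) (proj y) (frameObs (proj x) W) s) *
          (∑ s, b s * pathCoeff 0 (frameLayers U W) (proj y) (frameObs (proj x) W) s) := by
    rw [← Finset.mul_sum]
    push_cast
    simp_rw [sq, ofReal_pathEstimator, hb]
  have hR : ((frameCount ι d * ∑ s ∈ Finset.univ.filter
      (fun s : Fin (d + 1) → ι → Pauli => pathWeight s ≤ ℓ), a s ^ 2 * pathWt U y x₀ s : ℝ) : ℂ) =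
      ((4 : ℂ) ^ Fintype.card ι) ^ (d + 1) *
        ∑ s, b s * b s * (((2 : ℂ) ^ Fintype.card ι) ^ 2 * pathCoeff 0 U (proj y) (proj x₀) s ^ 2) := by
    unfold frameCount
    push_cast
    rw [Finset.sum_filter]
    congr 1
    exact Finset.sum_congr rfl fun s _ => by
      simp only [hb]
      split_ifs
      · rw [ofReal_pathWt, sq]
      · rw [zero_mul, zero_mul]
  have hreal : ∑ W : Fin (d + 1) → ι → Pauli, (2 : ℝ) ^ Fintype.card ι * ∑ x : ι → Bool,
      pathEstimator ℓ a U y W x ^ 2 =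
      frameCount ι d * ∑ s ∈ Finset.univ.filter
        (fun s : Fin (d + 1) → ι → Pauli => pathWeight s ≤ ℓ), a s ^ 2 * pathWt U y x₀ s := by
    exact_mod_cast hL.trans (hC.trans hR.symm)
  rw [hreal, sum_filter_le_eq_add, pathWt_const_I hU, mul_one, ownExcess]
  field_simp

/-- `κ_a ≥ 0`. [cite: AharonovEtAl2023, Definition 5] -/
theorem ownExcess_nonneg {d : ℕ} (ℓ : ℕ) (a : (Fin (d + 1) → ι → Pauli) → ℝ)
    (U : Fin d → Matrix (ι → Bool) (ι → Bool) ℂ) (y x₀ : ι → Bool) : 0 ≤ ownExcess ℓ a U y x₀ :=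
  Finset.sum_nonneg fun s _ => mul_nonneg (sq_nonneg _) (pathWt_nonneg U y x₀ s)

/-- **(c′) AMPLIFICATION-FREE CEILING** (Cauchy–Schwarz on (a)): for every coefficient profile,
`E_W[XEB(q_a)] ≤ (a_{I…I} − 1) + √(κ_a · W_{≤ℓ})` (unitary layers, basis input).
[cite: AharonovEtAl2023, Lemma 3 and Lemma 4] -/
theorem truncationClassCeilingCS {d : ℕ} (ℓ : ℕ) (a : (Fin (d + 1) → ι → Pauli) → ℝ)
    {U : Fin d → Matrix (ι → Bool) (ι → Bool) ℂ} (hU : ∀ t, U t ∈ Matrix.unitaryGroup (ι → Bool) ℂ)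
    (y x₀ : ι → Bool) :
    avgClassXEB ℓ a U y ≤
      (a (fun _ _ => Pauli.I) - 1) + Real.sqrt (ownExcess ℓ a U y x₀ * lowDegreeMass U y x₀ ℓ) := by
  rw [avgClassXEB_eq ℓ a hU y x₀, add_le_add_iff_left, ownExcess, lowDegreeMass_eq_sum_pathWt]
  set S := Finset.univ.filter
    (fun s : Fin (d + 1) → ι → Pauli => pathWeight s ≤ ℓ ∧ pathWeight s ≠ 0) with hS
  have hw : ∀ s, Real.sqrt (pathWt U y x₀ s) * Real.sqrt (pathWt U y x₀ s) = pathWt U y x₀ s :=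
    fun s => Real.mul_self_sqrt (pathWt_nonneg U y x₀ s)
  have hcs := Finset.sum_mul_sq_le_sq_mul_sq S (fun s => a s * Real.sqrt (pathWt U y x₀ s))
    (fun s => Real.sqrt (pathWt U y x₀ s))
  have h1 : ∑ s ∈ S, a s * Real.sqrt (pathWt U y x₀ s) * Real.sqrt (pathWt U y x₀ s) =
      ∑ s ∈ S, a s * pathWt U y x₀ s :=
    Finset.sum_congr rfl fun s _ => by rw [mul_assoc, hw]
  have h2 : ∑ s ∈ S, (a s * Real.sqrt (pathWt U y x₀ s)) ^ 2 = ∑ s ∈ S, a s ^ 2 * pathWt U y x₀ s :=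
    Finset.sum_congr rfl fun s _ => by rw [mul_pow, sq (Real.sqrt _), hw]
  have h3 : ∑ s ∈ S, Real.sqrt (pathWt U y x₀ s) ^ 2 = ∑ s ∈ S, pathWt U y x₀ s :=
    Finset.sum_congr rfl fun s _ => by rw [sq, hw]
  rw [h1, h2, h3] at hcs
  exact (le_abs_self _).trans (Real.abs_le_sqrt hcs)

/-! ### (P_κ) The positivity cap -/

/-- **`Σ_x q_{a,W}(x) = a_{I…I}`** for unitary layers and a basis input: only the trivial path has a
non-zero read-out total. [cite: AharonovEtAl2023, Lemma 4 (item 1) and Lemma 5] -/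
theorem sum_pathEstimator {d : ℕ} (ℓ : ℕ) (a : (Fin (d + 1) → ι → Pauli) → ℝ)
    {U : Fin d → Matrix (ι → Bool) (ι → Bool) ℂ} (hU : ∀ t, U t ∈ Matrix.unitaryGroup (ι → Bool) ℂ)
    (y : ι → Bool) (W : Fin (d + 1) → ι → Pauli) :
    ∑ x : ι → Bool, pathEstimator ℓ a U y W x = a (fun _ _ => Pauli.I) := by
  have hI : (fun _ _ => Pauli.I : Fin (d + 1) → ι → Pauli) ∈
      Finset.univ.filter (fun s : Fin (d + 1) → ι → Pauli => pathWeight s ≤ ℓ) := by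
    simp [pathWeight_eq_zero_iff.2 rfl]
  have h : ((∑ x : ι → Bool, pathEstimator ℓ a U y W x : ℝ) : ℂ) = ((a (fun _ _ => Pauli.I) : ℝ) : ℂ) := by
    push_cast
    simp_rw [ofReal_pathEstimator, ite_mul, zero_mul, ← Finset.sum_filter]
    rw [Finset.sum_comm]
    simp_rw [← Finset.mul_sum, sum_pathCoeff_frame_proj 0 hU y W, mul_ite, mul_one, mul_zero]
    rw [Finset.sum_ite_eq' _ (fun _ _ => Pauli.I : Fin (d + 1) → ι → Pauli), if_pos hI]
  exact_mod_cast h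

/-- **(P_κ) POSITIVITY CAP**: a path sum that IS point-wise non-negative in every frame, with
`a_{I…I} = 1` (so `Σ_x q_{a,W}(x) = 1`) and `q_{a,W}(x) ≤ M_W`, has own excess collision mass at most its
frame-averaged scaled peak minus one: `κ_a ≤ E_W[2ⁿ M_W] − 1` (from `Σ_x q² ≤ M_W Σ_x q`). A cap
only; no optimisation over profiles is stated. [cite: AharonovEtAl2023, Lemma 3 and Lemma 4 (item 1)] -/
theorem positivityCap {d : ℕ} (ℓ : ℕ) (a : (Fin (d + 1) → ι → Pauli) → ℝ)
    (haI : a (fun _ _ => Pauli.I) = 1)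
    {U : Fin d → Matrix (ι → Bool) (ι → Bool) ℂ} (hU : ∀ t, U t ∈ Matrix.unitaryGroup (ι → Bool) ℂ)
    (y x₀ : ι → Bool) (hpos : ∀ W x, 0 ≤ pathEstimator ℓ a U y W x)
    (M : (Fin (d + 1) → ι → Pauli) → ℝ) (hM : ∀ W x, pathEstimator ℓ a U y W x ≤ M W) :
    ownExcess ℓ a U y x₀ ≤
      (∑ W : Fin (d + 1) → ι → Pauli, (2 : ℝ) ^ Fintype.card ι * M W) / frameCount ι d - 1 := by
  have hF := frameCount_pos ι d
  have hid := ownExcessIdentity ℓ a hU y x₀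
  rw [haI, one_pow] at hid
  have hle : ∑ W : Fin (d + 1) → ι → Pauli, (2 : ℝ) ^ Fintype.card ι * ∑ x : ι → Bool,
      pathEstimator ℓ a U y W x ^ 2 ≤
      ∑ W : Fin (d + 1) → ι → Pauli, (2 : ℝ) ^ Fintype.card ι * M W := by
    refine Finset.sum_le_sum fun W _ => mul_le_mul_of_nonneg_left ?_ (by positivity)
    calc ∑ x : ι → Bool, pathEstimator ℓ a U y W x ^ 2
        ≤ ∑ x : ι → Bool, M W * pathEstimator ℓ a U y W x :=
          Finset.sum_le_sum fun x _ => by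
            rw [sq]
            exact mul_le_mul_of_nonneg_right (hM W x) (hpos W x)
      _ = M W := by rw [← Finset.mul_sum, sum_pathEstimator ℓ a hU y W, haI, mul_one]
  have := div_le_div_of_nonneg_right hle hF.le
  linarith

end PauliPath

end Literature.Computability.QuantumComplexity
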